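import Mathlib
import HarnessLib
import Summits.Ventures.LatticeQCDFlow.Scaling.HierarchicalVolumeLaw
import Summits.Ventures.LatticeQCDFlow.Scaling.AcceptanceVolumeSandwich

/-!
# LatticeQCDFlow / Scaling — the ACCEPTANCE companion of the hierarchical volume law:
# `acc(b, a)·(min_c O_c)² ≤ acc(b·ρ, a·κ) ≤ acc(b, a)` for a coarse law followed by a conditional
# flow, `O_c = Σ_x min(ρ_c(x), κ_c(x))` the conditional overlaps

HONEST FRAMING: exact (Metropolis-corrected) sampling algorithms for lattice gauge theory;
figures of merit are autocorrelation/cost numbers at stated couplings and volumes; no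
continuum-physics claim.

Venture `LatticeQCDFlow` (cell pub-lqcd), topic `Scaling`; FANOUT row 3 (`s0-u1-a`, S0-B
implementation A, GEN-11).  NEW WORK of the cell (elementary finite sums), not a published result;
NO definition is introduced.  Setting of the theory seat's `Scaling/HierarchicalVolumeLaw` (T2-AJ,
imported): finite coarse variable `c : C` (block spins, a separator field, a topological-sector
label) and fine variable `x : X`; a hierarchical TARGET `r = kerLaw b ρ` (`r(c, x) = b(c)·ρ_c(x)`)
and MODEL `q = kerLaw a κ` (`q(c, x) = a(c)·κ_c(x)`): coarse laws `b, a` and conditional laws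
`ρ_c, κ_c`, all nonnegative and normalised.  T2-AJ prices such models in KL and ESS (chain rule /
harmonic identity: the two levels pay SEPARATELY).  This file is the acceptance counterpart, using
row 3's super-multiplicativity inequality `min(u,u′)·min(v,v′) ≤ min(uv, u′v′)`
(`Scaling/AcceptanceVolumeSandwich`, imported).

* `accRate_kerLaw_eq` — the four-fold sum `acc(r, q) = Σ_{c,c′} Σ_{x,x′} min(b_c ρ_c(x)·a_{c′}κ_{c′}(x′),
  b_{c′}ρ_{c′}(x′)·a_c κ_c(x))`;
* **`accRate_kerLaw_le`** — `acc(b·ρ, a·κ) ≤ acc(b, a)`: the conditional level can only COST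
  acceptance (sum of minima ≤ minimum of sums; only the normalisation of `ρ`, `κ` is used);
* **`accRate_kerLaw_ge`** — `acc(b·ρ, a·κ) ≥ Σ_{c,c′} min(b_c a_{c′}, b_{c′} a_c)·O_c·O_{c′}` with the
  conditional OVERLAPS `O_c = Σ_x min(ρ_c(x), κ_c(x)) = 1 − TV(ρ_c, κ_c)` (two applications of the
  super-multiplicativity inequality); hence **`sq_mul_accRate_le_accRate_kerLaw`** —
  `o²·acc(b, a) ≤ acc(b·ρ, a·κ)` whenever every conditional overlap is `≥ o ≥ 0`, and
  `sq_mul_accRate_le_accRate_kerLaw_of_accRate` — the same with `o ≤ acc(ρ_c, κ_c)` (conditional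
  ACCEPTANCES, since `acc ≤ 1 − TV = O`, `accRate_le`);
* **`accRate_kerLaw_eq_of_perfect`** — perfect conditional flows (`κ = ρ`) give EQUALITY
  `acc(b·ρ, a·ρ) = acc(b, a)`: the global accept/reject step then sees the coarse weights only.
* `prod_overlap_le_overlap_blockProd` (`∏ᵢ Oᵢ ≤ O(⊗)`) and
  **`pow_mul_accRate_le_accRate_kerLaw_blockProd`** — in T2-AJ's setting (conditional model a
  PRODUCT over `m` fine blocks given `c`): conditional block overlaps `≥ o` force
  `o^(2m)·acc(b, a) ≤ acc ≤ acc(b, a)` — the acceptance analogue of the per-block ESS defect.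

Reading (value-free): a coarse-then-conditional (multiscale, domain-decomposition, sector-mixture)
flow used as an exact independence proposal accepts at most as often as its coarse level alone and
at least `acc_coarse × (worst conditional overlap)²`; with T2-AJ's `1/ESS = Σ_c (b_c²/a_c)/ESS_c`
the two monitors of such architectures are bracketed level by level.  NOT CLAIMED: anything about
flows that are not of `kerLaw` form; any acceptance of ours; nothing re-scored.
-/

namespace Summit.Ventures.LatticeQCDFlow.Theory2

open Finset
open Summit.Ventures.LatticeQCDFlow.Exactness

variable {C X : Type*} [Fintype C] [Fintype X]

/-- **The acceptance of a hierarchical pair as a four-fold sum.** [ours] -/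
theorem accRate_kerLaw_eq (b a : C → ℝ) (ρ κ : C → X → ℝ) :
    accRate (kerLaw b ρ) (kerLaw a κ)
      = ∑ c, ∑ c', ∑ x, ∑ x',
          min (b c * a c' * (ρ c x * κ c' x')) (b c' * a c * (κ c x * ρ c' x')) := by
  simp only [accRate, kerLaw, Fintype.sum_prod_type]
  refine sum_congr rfl fun c _ => ?_
  rw [sum_comm]
  refine sum_congr rfl fun c' _ => sum_congr rfl fun x _ => sum_congr rfl fun x' _ => ?_
  congr 1 <;> ring

/-- **The conditional level can only cost acceptance**: `acc(b·ρ, a·κ) ≤ acc(b, a)` for normalised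
conditional laws (`Σ_x ρ_c = Σ_x κ_c = 1`). [ours] -/
theorem accRate_kerLaw_le (b a : C → ℝ) {ρ κ : C → X → ℝ} (hρ1 : ∀ c, ∑ x, ρ c x = 1)
    (hκ1 : ∀ c, ∑ x, κ c x = 1) :
    accRate (kerLaw b ρ) (kerLaw a κ) ≤ accRate b a := by
  rw [accRate_kerLaw_eq]
  unfold accRate
  refine sum_le_sum fun c _ => sum_le_sum fun c' _ => ?_
  have h1 : ∑ x, ∑ x', ρ c x * κ c' x' = 1 := by rw [← sum_mul_sum, hρ1, hκ1, mul_one]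
  have h2 : ∑ x, ∑ x', κ c x * ρ c' x' = 1 := by rw [← sum_mul_sum, hκ1, hρ1, mul_one]
  refine le_min ?_ ?_
  · calc ∑ x, ∑ x', min (b c * a c' * (ρ c x * κ c' x')) (b c' * a c * (κ c x * ρ c' x'))
        ≤ ∑ x, ∑ x', b c * a c' * (ρ c x * κ c' x') :=
          sum_le_sum fun x _ => sum_le_sum fun x' _ => min_le_left _ _
      _ = b c * a c' * ∑ x, ∑ x', ρ c x * κ c' x' := by simp_rw [mul_sum]
      _ = b c * a c' := by rw [h1, mul_one]
  · calc ∑ x, ∑ x', min (b c * a c' * (ρ c x * κ c' x')) (b c' * a c * (κ c x * ρ c' x'))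
        ≤ ∑ x, ∑ x', b c' * a c * (κ c x * ρ c' x') :=
          sum_le_sum fun x _ => sum_le_sum fun x' _ => min_le_right _ _
      _ = b c' * a c * ∑ x, ∑ x', κ c x * ρ c' x' := by simp_rw [mul_sum]
      _ = b c' * a c := by rw [h2, mul_one]

/-- **The overlap floor**: `acc(b·ρ, a·κ) ≥ Σ_{c,c′} min(b_c a_{c′}, b_{c′} a_c)·O_c·O_{c′}` with
`O_c = Σ_x min(ρ_c(x), κ_c(x))`, for nonnegative data (termwise
`min(b_c a_{c′}·ρκ′, b_{c′}a_c·κρ′) ≥ min(b_c a_{c′}, b_{c′}a_c)·min(ρ_c(x), κ_c(x))·min(ρ_{c′}(x′), κ_{c′}(x′))`).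
[ours] -/
theorem accRate_kerLaw_ge {b a : C → ℝ} {ρ κ : C → X → ℝ} (hb : ∀ c, 0 ≤ b c) (ha : ∀ c, 0 ≤ a c)
    (hρ : ∀ c x, 0 ≤ ρ c x) (hκ : ∀ c x, 0 ≤ κ c x) :
    ∑ c, ∑ c', min (b c * a c') (b c' * a c)
        * ((∑ x, min (ρ c x) (κ c x)) * ∑ x', min (ρ c' x') (κ c' x'))
      ≤ accRate (kerLaw b ρ) (kerLaw a κ) := by
  rw [accRate_kerLaw_eq]
  refine sum_le_sum fun c _ => sum_le_sum fun c' _ => ?_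
  rw [sum_mul_sum, mul_sum]
  refine sum_le_sum fun x _ => ?_
  rw [mul_sum]
  refine sum_le_sum fun x' _ => ?_
  have hinner : min (ρ c x) (κ c x) * min (ρ c' x') (κ c' x')
      ≤ min (ρ c x * κ c' x') (κ c x * ρ c' x') := by
    rw [min_comm (ρ c' x') (κ c' x')]
    exact min_mul_min_le_min_mul (hρ c x) (hκ c x) (hκ c' x') (hρ c' x')
  calc min (b c * a c') (b c' * a c) * (min (ρ c x) (κ c x) * min (ρ c' x') (κ c' x'))
      ≤ min (b c * a c') (b c' * a c) * min (ρ c x * κ c' x') (κ c x * ρ c' x') :=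
        mul_le_mul_of_nonneg_left hinner
          (le_min (mul_nonneg (hb c) (ha c')) (mul_nonneg (hb c') (ha c)))
    _ ≤ min (b c * a c' * (ρ c x * κ c' x')) (b c' * a c * (κ c x * ρ c' x')) :=
        min_mul_min_le_min_mul (mul_nonneg (hb c) (ha c')) (mul_nonneg (hb c') (ha c))
          (mul_nonneg (hρ c x) (hκ c' x')) (mul_nonneg (hκ c x) (hρ c' x'))

/-- **`o²·acc(b, a) ≤ acc(b·ρ, a·κ)`** whenever every conditional overlap is at least `o ≥ 0`:
the acceptance of a coarse-then-conditional flow is at least the coarse acceptance times the square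
of the worst conditional overlap. [ours] -/
theorem sq_mul_accRate_le_accRate_kerLaw {b a : C → ℝ} {ρ κ : C → X → ℝ} (hb : ∀ c, 0 ≤ b c)
    (ha : ∀ c, 0 ≤ a c) (hρ : ∀ c x, 0 ≤ ρ c x) (hκ : ∀ c x, 0 ≤ κ c x) {o : ℝ} (ho0 : 0 ≤ o)
    (ho : ∀ c, o ≤ ∑ x, min (ρ c x) (κ c x)) :
    o ^ 2 * accRate b a ≤ accRate (kerLaw b ρ) (kerLaw a κ) := by
  refine le_trans ?_ (accRate_kerLaw_ge hb ha hρ hκ)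
  unfold accRate
  rw [mul_sum]
  refine sum_le_sum fun c _ => ?_
  rw [mul_sum]
  refine sum_le_sum fun c' _ => ?_
  rw [mul_comm (o ^ 2), sq]
  exact mul_le_mul_of_nonneg_left (mul_le_mul (ho c) (ho c') ho0
    ((ho0.trans (ho c)))) (le_min (mul_nonneg (hb c) (ha c')) (mul_nonneg (hb c') (ha c)))

/-- **The same with conditional ACCEPTANCES**: if every conditional pair accepts at least `o ≥ 0`
(`o ≤ acc(ρ_c, κ_c)`), then `o²·acc(b, a) ≤ acc(b·ρ, a·κ)` — because an acceptance never exceeds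
the overlap (`acc ≤ 1 − TV = Σ min(ρ, κ)`). [ours] -/
theorem sq_mul_accRate_le_accRate_kerLaw_of_accRate {b a : C → ℝ} {ρ κ : C → X → ℝ}
    (hb : ∀ c, 0 ≤ b c) (ha : ∀ c, 0 ≤ a c) (hρ : ∀ c x, 0 ≤ ρ c x) (hκ : ∀ c x, 0 ≤ κ c x)
    (hρ1 : ∀ c, ∑ x, ρ c x = 1) (hκ1 : ∀ c, ∑ x, κ c x = 1) {o : ℝ} (ho0 : 0 ≤ o)
    (ho : ∀ c, o ≤ accRate (ρ c) (κ c)) :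
    o ^ 2 * accRate b a ≤ accRate (kerLaw b ρ) (kerLaw a κ) := by
  classical
  refine sq_mul_accRate_le_accRate_kerLaw hb ha hρ hκ ho0 fun c => (ho c).trans ?_
  rw [sum_min_eq_one_sub_tvDist (hρ1 c) (hκ1 c)]
  exact accRate_le (hρ1 c) (hκ1 c)

/-- **Perfect conditional flows see only the coarse weights**: `acc(b·ρ, a·ρ) = acc(b, a)` for
nonnegative normalised data. [ours] -/
theorem accRate_kerLaw_eq_of_perfect {b a : C → ℝ} {ρ : C → X → ℝ} (hb : ∀ c, 0 ≤ b c)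
    (ha : ∀ c, 0 ≤ a c) (hρ : ∀ c x, 0 ≤ ρ c x) (hρ1 : ∀ c, ∑ x, ρ c x = 1) :
    accRate (kerLaw b ρ) (kerLaw a ρ) = accRate b a := by
  refine le_antisymm (accRate_kerLaw_le b a hρ1 hρ1) ?_
  have h := sq_mul_accRate_le_accRate_kerLaw hb ha hρ hρ zero_le_one (o := 1) fun c => by
    rw [← hρ1 c]
    exact le_of_eq (sum_congr rfl fun x _ => (min_self _).symm)
  simpa using h


/-! ### Conditional BLOCK products: the acceptance companion of T2-AJ's setting -/

section Blocks

variable {Z : Type*} [Fintype Z] {m : ℕ}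

/-- **The overlap of block products is at least the product of the block overlaps**:
`∏ᵢ Σ_z min(ρᵢ(z), kᵢ(z)) ≤ Σ_φ min(∏ᵢ ρᵢ(φᵢ), ∏ᵢ kᵢ(φᵢ))` for nonnegative block laws
(`∏ min ≤ min ∏`, then `∏ Σ = Σ ∏`). [ours] -/
theorem prod_overlap_le_overlap_blockProd {ρ k : Fin m → Z → ℝ} (hρ : ∀ i z, 0 ≤ ρ i z)
    (hk : ∀ i z, 0 ≤ k i z) :
    ∏ i, ∑ z, min (ρ i z) (k i z) ≤ ∑ φ : Fin m → Z, min (blockProd ρ φ) (blockProd k φ) := by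
  rw [Fintype.prod_sum]
  refine sum_le_sum fun φ _ => le_min ?_ ?_
  · exact prod_le_prod (fun i _ => le_min (hρ i _) (hk i _)) fun i _ => min_le_left _ _
  · exact prod_le_prod (fun i _ => le_min (hρ i _) (hk i _)) fun i _ => min_le_right _ _

/-- **HIERARCHICAL ACCEPTANCE FLOOR** (the setting of T2-AJ: coarse law, then a conditional model
that is a PRODUCT over `m` fine blocks given `c`): if every conditional block overlap is at least
`o ∈ [0, 1]` (`o ≤ Σ_z min(ρ_{c,i}(z), k_{c,i}(z))` for all `c`, `i`), then
`o^(2m) · acc(b, a) ≤ acc(b·⊗ρ, a·⊗k)` — against the ceiling `acc ≤ acc(b, a)`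
(`accRate_kerLaw_le`): per fine block the acceptance of a hierarchical flow loses at most the factor
`o²`. [ours] -/
theorem pow_mul_accRate_le_accRate_kerLaw_blockProd {b a : C → ℝ} {ρ k : C → Fin m → Z → ℝ}
    (hb : ∀ c, 0 ≤ b c) (ha : ∀ c, 0 ≤ a c) (hρ : ∀ c i z, 0 ≤ ρ c i z) (hk : ∀ c i z, 0 ≤ k c i z)
    {o : ℝ} (ho0 : 0 ≤ o) (ho : ∀ c i, o ≤ ∑ z, min (ρ c i z) (k c i z)) :
    o ^ (2 * m) * accRate b a
      ≤ accRate (kerLaw b fun c => blockProd (ρ c)) (kerLaw a fun c => blockProd (k c)) := by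
  rw [pow_mul']
  refine sq_mul_accRate_le_accRate_kerLaw hb ha
    (fun c φ => prod_nonneg fun i _ => hρ c i _) (fun c φ => prod_nonneg fun i _ => hk c i _)
    (pow_nonneg ho0 m) fun c => ?_
  calc o ^ m = ∏ _i : Fin m, o := by rw [Fin.prod_const]
    _ ≤ ∏ i, ∑ z, min (ρ c i z) (k c i z) :=
        prod_le_prod (fun i _ => ho0) fun i _ => ho c i
    _ ≤ ∑ φ : Fin m → Z, min (blockProd (ρ c) φ) (blockProd (k c) φ) :=
        prod_overlap_le_overlap_blockProd (hρ c) (hk c)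

end Blocks

end Summit.Ventures.LatticeQCDFlow.Theory2
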